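import Summits.HodgeConjecture.HodgeConjecture.Theorems.Ring2WeilCoverageCMFieldRationalClassesDFourSupport
import Summits.HodgeConjecture.HodgeConjecture.Theorems.Ring2WeilCoverageCMFieldRationalClassesDFourAssembly
import HarnessLib

/-!
# Ring 2 — Weil-family coverage, CM-field rows: THE SPAN OF THE RATIONAL ROWS of the non-Galois table `E = ℚ(√-(3+√2))` —
  which sets of places of `F = ℚ(√2)` ARE rational rows `T(c)`, `c ∈ ℚ_{>0}`, as ONE kernel statement
  (WEIL-FAMILY-COVERAGE «## b03», cell (xvi′), sufficiency; part 60)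

research route conditional on HC_CM; not a corollary; Q11.4-sentence-2 already refuted in dim ≥ 3.

Carrier `R = S² + 6S + 7` (`θ = -3 ± √2`, `θθ' = 7`; `v₂ = (√2)` the dyadic place, `𝔭_θ = (7, θ)`, `Z = {v₂, 𝔭_θ}`; rows
`T(t) = badPlaces t θ = {𝔭 : (t, θ)_𝔭 = -1}`) [cite: Deligne1982HodgeCycles, §4 (1), Cor. 4.2].  Parts 54–59 decided every place of
`F` against every prime row `T(ℓ)`, cut the rational rows out of the finite even sets of places by NECESSARY conditions (part 57)
and assembled the squarefree rows prime by prime (part 59).  This file closes the cell with the converse: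

* §171 (ANY carrier) **THE SQUAREFREE KERNEL**: for `c ∈ ℚ_{>0}`, **`T(c) = T(∏ ℓ)`, the product over the primes `ℓ` with `ord_ℓ(c)`
  odd** — every rational row is the row of a squarefree positive integer (parity of the prime support);
* §172 a set-theoretic parity step: two finite EVEN sets agreeing off a pair `{a, b}` are equal or differ exactly by the pair;
* §173 **SUFFICIENCY**: a finite EVEN set `S` of places of `F`, without infinite places, whose places off `Z` are bad places
  `u ∈ T(ℓ)` of the prime `ℓ` under them, and which is SATURATED along the prime pieces (`u ∈ S` over `ℓ` and `u' ∈ T(ℓ) ∖ Z ⟹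
  u' ∈ S` — the both-or-none condition of part 57 at the private non-lonely split primes; automatic at inert and lonely primes), IS a
  rational row: **`S = T(n)` or `S = T(7n)` with `n = ∏ ℓ` over the primes under `S ∖ Z`** (`T(7) = Z` repairs the parities at
  `v₂`, `𝔭_θ`);
* §174 **THE SPAN THEOREM** `dFour_exists_ratCast_badPlaces_eq_iff`: **`(∃ c ∈ ℚ_{>0}, T(c) = S) ⟺` `S` finite ∧ `|S|` even ∧ no
  infinite place ∧ support ∧ saturation** — the necessity half being part 57 with Hilbert reciprocity (O'Meara 71:18).
No new definition, no named fact, no sorry; nothing about the Hodge conjecture is asserted.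
-/

noncomputable section

set_option linter.dupNamespace false

open Polynomial NumberField IsDedekindDomain

namespace Summit.HodgeConjecture.HodgeConjecture.Ring2.WeilCoverageCM

open Literature.AlgebraicGeometry.Deligne1982
open Literature.NumberTheory.QuadraticForms

variable {R : Polynomial ℤ} [Fact (Irreducible (cmPolyQ R))] [Fact (Irreducible (realPolyQ R))]

/-! ### §171 The squarefree kernel of a rational row — every carrier -/

section SquarefreeKernel

/-- Parity bookkeeping: **the parity of `∑_{ℓ : Q ℓ} f(ℓ)` is the parity of the number of `ℓ` with `Q ℓ` and `f(ℓ)` odd**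
(`f` finitely supported). [folklore] -/
theorem odd_finsupp_sum_ite_iff (f : ℕ →₀ ℕ) (Q : ℕ → Prop) [DecidablePred Q] :
    Odd (f.sum fun ℓ e ↦ if Q ℓ then e else 0) ↔ Odd (f.support.filter fun ℓ ↦ Q ℓ ∧ Odd (f ℓ)).card := by
  have key : ∀ ℓ, (if Q ℓ then f ℓ else 0) % 2 = if Q ℓ ∧ Odd (f ℓ) then 1 else 0 := by
    intro ℓ
    by_cases hQ : Q ℓ
    · by_cases ho : Odd (f ℓ)
      · rw [if_pos hQ, if_pos ⟨hQ, ho⟩]; exact Nat.odd_iff.1 ho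
      · rw [if_pos hQ, if_neg fun h ↦ ho h.2]; exact Nat.even_iff.1 (Nat.not_odd_iff_even.1 ho)
    · rw [if_neg hQ, if_neg fun h ↦ hQ h.1]
  rw [Finsupp.sum, Nat.odd_iff, Nat.odd_iff, Finset.sum_nat_mod, Finset.card_filter]
  simp_rw [key]

/-- For a prime `ℓ` and `c ∈ ℚ^×`: **`ord_ℓ(c)` is odd iff the exponent of `ℓ` in `num(c)·den(c)` is odd**
(`ord_ℓ(c) = v_ℓ(num c) - v_ℓ(den c)`). [folklore] -/
theorem odd_padicValRat_iff_odd_factorization {c : ℚ} (hc : c ≠ 0) {ℓ : ℕ} (hℓ : ℓ.Prime) :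
    Odd (padicValRat ℓ c) ↔ Odd ((c.num.natAbs * c.den).factorization ℓ) := by
  have hnum : c.num.natAbs ≠ 0 := Int.natAbs_ne_zero.2 (Rat.num_ne_zero.2 hc)
  rw [Nat.factorization_mul hnum c.den_nz, Finsupp.add_apply, Nat.factorization_def _ hℓ, Nat.factorization_def _ hℓ,
    padicValRat_def, padicValInt, Int.odd_sub, Nat.odd_add, Int.odd_coe_nat, Int.even_coe_nat]

open scoped Classical in
/-- **THE SQUAREFREE KERNEL OF A RATIONAL ROW** (any of Deligne's carriers): for `c ∈ ℚ_{>0}`,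
**`T(c) = T(∏ ℓ)`, the product over the primes `ℓ ∣ num(c)·den(c)` with `ord_ℓ(c)` odd** — both sides contain a place `x` iff the
number of such primes with `x ∈ T(ℓ)` is odd (parity of the prime support, parts 46∕58).  Every rational row is the row of a
squarefree positive integer. [cite: Deligne1982HodgeCycles, §4 (1)] [cite: Omeara1963, §63B (multiplicativity of the symbol)] -/
theorem badPlaces_ratCast_eq_badPlaces_prod_primes {c : ℚ} (hc : 0 < c) :
    badPlaces (c : realField R) (AdjoinRoot.root (realPolyQ R)) =
      badPlaces ((∏ ℓ ∈ (c.num.natAbs * c.den).primeFactors.filter (fun ℓ ↦ Odd (padicValRat ℓ c)), ℓ : ℕ) : realField R)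
        (AdjoinRoot.root (realPolyQ R)) := by
  set P := (c.num.natAbs * c.den).primeFactors.filter (fun ℓ ↦ Odd (padicValRat ℓ c)) with hP
  have hPp : ∀ ℓ ∈ P, ℓ.Prime := fun ℓ hℓ ↦ Nat.prime_of_mem_primeFactors (Finset.mem_filter.1 hℓ).1
  ext x
  rw [mem_badPlaces_ratCast_iff_odd_sum_factorization x
      (fun ℓ ↦ x ∈ badPlaces (ℓ : realField R) (AdjoinRoot.root (realPolyQ R))) (fun _ _ ↦ Iff.rfl) hc,
    mem_badPlaces_natCast_prod_iff_odd_card P (fun ℓ ↦ ℓ) (fun ℓ hℓ ↦ (hPp ℓ hℓ).ne_zero) x,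
    odd_finsupp_sum_ite_iff]
  have hset : ((c.num.natAbs * c.den).factorization.support.filter fun ℓ : ℕ ↦
      x ∈ badPlaces (ℓ : realField R) (AdjoinRoot.root (realPolyQ R)) ∧ Odd ((c.num.natAbs * c.den).factorization ℓ)) =
      P.filter fun ℓ : ℕ ↦ x ∈ badPlaces (ℓ : realField R) (AdjoinRoot.root (realPolyQ R)) := by
    ext ℓ
    rw [Finset.mem_filter, Finset.mem_filter, hP, Finset.mem_filter, Nat.support_factorization]
    constructor
    · rintro ⟨hℓ, hx, ho⟩
      exact ⟨⟨hℓ, (odd_padicValRat_iff_odd_factorization hc.ne' (Nat.prime_of_mem_primeFactors hℓ)).2 ho⟩, hx⟩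
    · rintro ⟨⟨hℓ, ho⟩, hx⟩
      exact ⟨hℓ, hx, (odd_padicValRat_iff_odd_factorization hc.ne' (Nat.prime_of_mem_primeFactors hℓ)).1 ho⟩
  rw [hset]

end SquarefreeKernel

/-! ### §172 A parity step: even sets agreeing off a pair -/

section Parity

variable {α : Type*}

/-- If two sets agree off one point `b`, `b ∈ A ∖ B`, and `A` is finite of even size, then `|B| = |A| - 1` is odd. [folklore] -/
theorem not_even_ncard_of_agree_off {A B : Set α} (hA : A.Finite) {b : α} (hagree : ∀ x, x ≠ b → (x ∈ A ↔ x ∈ B))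
    (hbA : b ∈ A) (hbB : b ∉ B) (heA : Even A.ncard) : ¬ Even B.ncard := by
  have hB : B = A \ {b} := by
    ext x
    rw [Set.mem_sdiff, Set.mem_singleton_iff]
    by_cases hx : x = b
    · subst hx; exact ⟨fun h ↦ absurd h hbB, fun h ↦ absurd rfl h.2⟩
    · rw [← hagree x hx]; exact ⟨fun h ↦ ⟨h, hx⟩, fun h ↦ h.1⟩
  have h := Set.ncard_sdiff_singleton_add_one hbA hA
  rw [← hB] at h
  intro heB
  obtain ⟨k, hk⟩ := heA
  obtain ⟨m, hm⟩ := heB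
  omega

/-- **Two finite EVEN sets which agree off a pair `{a, b}` (`a ≠ b`) are EQUAL or differ exactly by the pair:
`A = S ∨ {a, b} ∆ A = S`** (if they disagreed at exactly one of `a`, `b`, their sizes would differ by one). [folklore] -/
theorem eq_or_symmDiff_pair_eq_of_agree_off {A S : Set α} (hA : A.Finite) (hS : S.Finite) (heA : Even A.ncard)
    (heS : Even S.ncard) {a b : α} (hagree : ∀ x, x ≠ a → x ≠ b → (x ∈ A ↔ x ∈ S)) :
    A = S ∨ symmDiff {a, b} A = S := by
  by_cases ha : (a ∈ A ↔ a ∈ S) <;> by_cases hb : (b ∈ A ↔ b ∈ S)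
  · left
    ext x
    by_cases hxa : x = a
    · subst hxa; exact ha
    by_cases hxb : x = b
    · subst hxb; exact hb
    exact hagree x hxa hxb
  · exfalso
    have hagree' : ∀ x, x ≠ b → (x ∈ A ↔ x ∈ S) := fun x hxb ↦ by
      by_cases hxa : x = a
      · subst hxa; exact ha
      · exact hagree x hxa hxb
    by_cases hbA : b ∈ A
    · exact not_even_ncard_of_agree_off hA hagree' hbA (fun h ↦ hb (iff_of_true hbA h)) heA heS
    · have hbS : b ∈ S := by by_contra h; exact hb (iff_of_false hbA h)
      exact not_even_ncard_of_agree_off hS (fun x hx ↦ (hagree' x hx).symm) hbS hbA heS heA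
  · exfalso
    have hagree' : ∀ x, x ≠ a → (x ∈ A ↔ x ∈ S) := fun x hxa ↦ by
      by_cases hxb : x = b
      · subst hxb; exact hb
      · exact hagree x hxa hxb
    by_cases haA : a ∈ A
    · exact not_even_ncard_of_agree_off hA hagree' haA (fun h ↦ ha (iff_of_true haA h)) heA heS
    · have haS : a ∈ S := by by_contra h; exact ha (iff_of_false haA h)
      exact not_even_ncard_of_agree_off hS (fun x hx ↦ (hagree' x hx).symm) haS haA heS heA
  · right
    ext x
    rw [Set.mem_symmDiff, Set.mem_insert_iff, Set.mem_singleton_iff]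
    by_cases hxa : x = a
    · subst hxa
      constructor
      · rintro (⟨-, hnA⟩ | ⟨-, hn⟩)
        · by_contra hnS; exact ha (iff_of_false hnA hnS)
        · exact absurd (Or.inl rfl) hn
      · exact fun hxS ↦ Or.inl ⟨Or.inl rfl, fun hxA ↦ ha (iff_of_true hxA hxS)⟩
    by_cases hxb : x = b
    · subst hxb
      constructor
      · rintro (⟨-, hnA⟩ | ⟨-, hn⟩)
        · by_contra hnS; exact hb (iff_of_false hnA hnS)
        · exact absurd (Or.inr rfl) hn
      · exact fun hxS ↦ Or.inl ⟨Or.inr rfl, fun hxA ↦ hb (iff_of_true hxA hxS)⟩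
    constructor
    · rintro (⟨h, -⟩ | ⟨hxA, -⟩)
      · exact absurd h (not_or.2 ⟨hxa, hxb⟩)
      · exact (hagree x hxa hxb).1 hxA
    · exact fun hxS ↦ Or.inr ⟨(hagree x hxa hxb).2 hxS, not_or.2 ⟨hxa, hxb⟩⟩

end Parity

/-! ### §173 `ℚ(√-(3+√2))`: sufficiency — admissible even sets are rational rows -/

section DFourSpan

/-- **`ℚ(√-(3+√2))` — ADMISSIBLE EVEN SETS ARE RATIONAL ROWS.**  Let `S` be a finite set of places of `F = ℚ(√2)` of EVEN size, without
infinite places, such that (support) every `u ∈ S` off `Z = {v₂, 𝔭_θ}` is a bad place `u ∈ T(ℓ)` of the prime `ℓ` under it, and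
(saturation) whenever `S` contains a place `u ∉ Z` over `ℓ` it contains every `u' ∈ T(ℓ) ∖ Z`.  Let `P` be the set of primes under
`S ∖ Z` and `n = ∏_{ℓ ∈ P} ℓ`.  Then **`S = T(n)` or `S = T(7n)`**: off `Z` both `T(n)` (part 59: `T(n) ∖ Z = ⋃_{ℓ ∈ P} (T(ℓ) ∖ Z)`,
part 55: every place of `T(ℓ) ∖ Z` lies over `ℓ`) and `S` consist of the whole prime pieces `T(ℓ) ∖ Z`, `ℓ ∈ P`; inside `Z` two even
sets agreeing off `Z` are equal or differ by `Z = T(7)` (Hilbert reciprocity 71:18 for `T(n)`; §172).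
[cite: Deligne1982HodgeCycles, §4 (1)] [cite: Omeara1963, §63B Example 63:12 and §71D Thm. 71:18] -/
theorem dFour_exists_primes_badPlaces_prod_eq (hR : R = X ^ 2 + C 6 * X + C 7) {θₒ : 𝓞 (realField R)}
    (hθ : (θₒ : realField R) = AdjoinRoot.root (realPolyQ R)) (v₂ : HeightOneSpectrum (𝓞 (realField R)))
    (h2 : (2 : 𝓞 (realField R)) ∈ v₂.asIdeal) (w : HeightOneSpectrum (𝓞 (realField R)))
    (h7w : ((7 : ℕ) : 𝓞 (realField R)) ∈ w.asIdeal) (hθw : θₒ ∈ w.asIdeal)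
    {S : Set (HeightOneSpectrum (𝓞 (realField R)) ⊕ InfinitePlace (realField R))} (hfin : S.Finite)
    (heven : Even S.ncard) (hinf : ∀ w' : InfinitePlace (realField R), Sum.inr w' ∉ S)
    (hsupp : ∀ u : HeightOneSpectrum (𝓞 (realField R)), Sum.inl u ∈ S → u ≠ v₂ → u ≠ w →
      ∃ ℓ : ℕ, ℓ.Prime ∧ (ℓ : 𝓞 (realField R)) ∈ u.asIdeal ∧
        Sum.inl u ∈ badPlaces (ℓ : realField R) (AdjoinRoot.root (realPolyQ R)))
    (hsat : ∀ ℓ : ℕ, ℓ.Prime → ∀ u u' : HeightOneSpectrum (𝓞 (realField R)), u ≠ v₂ → u ≠ w → u' ≠ v₂ → u' ≠ w →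
      (ℓ : 𝓞 (realField R)) ∈ u.asIdeal → Sum.inl u ∈ S →
      Sum.inl u' ∈ badPlaces (ℓ : realField R) (AdjoinRoot.root (realPolyQ R)) → Sum.inl u' ∈ S) :
    ∃ P : Finset ℕ,
      (∀ ℓ : ℕ, ℓ ∈ P ↔ ℓ.Prime ∧ ∃ u : HeightOneSpectrum (𝓞 (realField R)),
        Sum.inl u ∈ S \ {Sum.inl v₂, Sum.inl w} ∧ (ℓ : 𝓞 (realField R)) ∈ u.asIdeal) ∧
      (badPlaces ((∏ ℓ ∈ P, ℓ : ℕ) : realField R) (AdjoinRoot.root (realPolyQ R)) = S ∨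
        badPlaces ((7 * ∏ ℓ ∈ P, ℓ : ℕ) : realField R) (AdjoinRoot.root (realPolyQ R)) = S) := by
  have hsev : (7 : ℕ).Prime := by norm_num
  have h2w : (2 : 𝓞 (realField R)) ∉ w.asIdeal := two_notMem_of_natCast_mem hsev (by norm_num) w h7w
  have hvw : (Sum.inl v₂ : HeightOneSpectrum (𝓞 (realField R)) ⊕ InfinitePlace (realField R)) ≠ Sum.inl w :=
    fun h ↦ h2w (by rw [← Sum.inl_injective h]; exact h2)
  -- membership in `Z = {v₂, 𝔭_θ}`
  have hne_of : ∀ {u : HeightOneSpectrum (𝓞 (realField R))},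
      Sum.inl u ∉ ({Sum.inl v₂, Sum.inl w} : Set (HeightOneSpectrum (𝓞 (realField R)) ⊕ InfinitePlace (realField R))) →
        u ≠ v₂ ∧ u ≠ w := fun hZ ↦
    ⟨fun h ↦ hZ (by rw [h]; exact Set.mem_insert _ _), fun h ↦ hZ (by rw [h]; exact Set.mem_insert_of_mem _ (Set.mem_singleton _))⟩
  have hZ_of : ∀ {u : HeightOneSpectrum (𝓞 (realField R))}, u ≠ v₂ → u ≠ w →
      Sum.inl u ∉ ({Sum.inl v₂, Sum.inl w} : Set (HeightOneSpectrum (𝓞 (realField R)) ⊕ InfinitePlace (realField R))) :=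
    fun hv hw hZ ↦ by
      rcases hZ with h | h
      · exact hv (Sum.inl_injective h)
      · exact hw (Sum.inl_injective h)
  -- every place of `S ∖ Z` is a finite place off `Z`
  have hoff : ∀ x ∈ S \ {Sum.inl v₂, Sum.inl w}, ∃ u : HeightOneSpectrum (𝓞 (realField R)), x = Sum.inl u := by
    rintro (u | w') ⟨hxS, -⟩
    · exact ⟨u, rfl⟩
    · exact absurd hxS (hinf w')
  -- the prime under a finite place, and the primes under `S ∖ Z`
  choose pr hpr using fun v : HeightOneSpectrum (𝓞 (realField R)) ↦ exists_prime_natCast_mem v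
  have hpr_eq : ∀ (u : HeightOneSpectrum (𝓞 (realField R))) {ℓ : ℕ}, ℓ.Prime → (ℓ : 𝓞 (realField R)) ∈ u.asIdeal → pr u = ℓ :=
    fun u ℓ hℓ hℓu ↦ prime_natCast_mem_unique (hpr u).1 hℓ u (hpr u).2 hℓu
  have hSZ : (S \ {Sum.inl v₂, Sum.inl w}).Finite := hfin.sdiff
  obtain ⟨P, hP⟩ : ∃ P : Finset ℕ, P = hSZ.toFinset.image (Sum.elim pr fun _ ↦ 2) := ⟨_, rfl⟩
  have hPiff : ∀ ℓ : ℕ, ℓ ∈ P ↔ ℓ.Prime ∧ ∃ u : HeightOneSpectrum (𝓞 (realField R)),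
      Sum.inl u ∈ S \ {Sum.inl v₂, Sum.inl w} ∧ (ℓ : 𝓞 (realField R)) ∈ u.asIdeal := by
    intro ℓ
    rw [hP, Finset.mem_image]
    constructor
    · rintro ⟨x, hx, rfl⟩
      have hx' := hSZ.mem_toFinset.1 hx
      obtain ⟨u, rfl⟩ := hoff x hx'
      exact ⟨(hpr u).1, u, hx', (hpr u).2⟩
    · rintro ⟨hℓ, u, hu, hℓu⟩
      exact ⟨Sum.inl u, hSZ.mem_toFinset.2 hu, hpr_eq u hℓ hℓu⟩
  have hPprime : ∀ ℓ ∈ P, ℓ.Prime := fun ℓ hℓ ↦ ((hPiff ℓ).1 hℓ).1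
  -- off `Z`, `T(n)` and `S` agree
  have hagree : ∀ x ∉ ({Sum.inl v₂, Sum.inl w} : Set (HeightOneSpectrum (𝓞 (realField R)) ⊕ InfinitePlace (realField R))),
      x ∈ badPlaces ((∏ ℓ ∈ P, ℓ : ℕ) : realField R) (AdjoinRoot.root (realPolyQ R)) ↔ x ∈ S := by
    intro x hxZ
    rw [dFour_mem_badPlaces_prod_primes_iff hR hθ v₂ h2 w h7w hθw P hPprime hxZ]
    constructor
    · rintro ⟨ℓ, hℓP, hxℓ⟩
      obtain ⟨hℓ, u, huS, hℓu⟩ := (hPiff ℓ).1 hℓP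
      have hxv : x ∉ ({Sum.inl v₂} : Set _) := fun h ↦ hxZ (Set.mem_insert_iff.2 (Or.inl h))
      obtain ⟨u', rfl, -, hu'T, hu'⟩ :=
        dFour_exists_of_mem_badPlaces_natCast_diff_dyadic hR hθ v₂ h2 w h7w hθw hℓ ⟨hxℓ, hxv⟩
      obtain ⟨hu'v, hu'w⟩ := hne_of hxZ
      obtain ⟨huv, huw⟩ := hne_of huS.2
      exact hsat ℓ hℓ u u' huv huw hu'v hu'w hℓu huS.1 hu'T
    · intro hxS
      obtain ⟨u, rfl⟩ := hoff x ⟨hxS, hxZ⟩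
      obtain ⟨huv, huw⟩ := hne_of hxZ
      obtain ⟨ℓ, hℓ, hℓu, huT⟩ := hsupp u hxS huv huw
      exact ⟨ℓ, (hPiff ℓ).2 ⟨hℓ, u, ⟨hxS, hxZ⟩, hℓu⟩, huT⟩
  -- parity inside `Z`: `T(n)` is even (Hilbert reciprocity), `S` is even
  have hn0 : ((∏ ℓ ∈ P, ℓ : ℕ) : realField R) ≠ 0 := by
    exact_mod_cast Finset.prod_ne_zero_iff.2 fun ℓ hℓ ↦ (hPprime ℓ hℓ).ne_zero
  have hTe := even_ncard_badPlaces (R := R) (Units.mk0 _ hn0)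
  rw [Units.val_mk0] at hTe
  refine ⟨P, hPiff, ?_⟩
  rcases eq_or_symmDiff_pair_eq_of_agree_off hTe.1 hfin hTe.2 heven (a := Sum.inl v₂) (b := Sum.inl w)
      (fun x hxa hxb ↦ hagree x (by rintro (h | h); exacts [hxa h, hxb h])) with h | h
  · exact Or.inl h
  · right
    have h70 : ((7 : ℕ) : realField R) ≠ 0 := by exact_mod_cast hsev.ne_zero
    rw [Nat.cast_mul, badPlaces_mul h70 hn0 root_realPolyQ_ne_zero, dFour_badPlaces_seven hR hθ v₂ h2 w h7w hθw]
    exact h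

/-- **`ℚ(√-(3+√2))` — SUFFICIENCY, rational form**: under the hypotheses of `dFour_exists_primes_badPlaces_prod_eq` (finite, even,
no infinite place, support, saturation) **`S = T(c)` for some `c ∈ ℚ_{>0}`** (`c = n` or `7n`).
[cite: Deligne1982HodgeCycles, §4 (1)] [cite: Omeara1963, §63B Example 63:12 and §71D Thm. 71:18] -/
theorem dFour_exists_ratCast_badPlaces_eq (hR : R = X ^ 2 + C 6 * X + C 7) {θₒ : 𝓞 (realField R)}
    (hθ : (θₒ : realField R) = AdjoinRoot.root (realPolyQ R)) (v₂ : HeightOneSpectrum (𝓞 (realField R)))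
    (h2 : (2 : 𝓞 (realField R)) ∈ v₂.asIdeal) (w : HeightOneSpectrum (𝓞 (realField R)))
    (h7w : ((7 : ℕ) : 𝓞 (realField R)) ∈ w.asIdeal) (hθw : θₒ ∈ w.asIdeal)
    {S : Set (HeightOneSpectrum (𝓞 (realField R)) ⊕ InfinitePlace (realField R))} (hfin : S.Finite)
    (heven : Even S.ncard) (hinf : ∀ w' : InfinitePlace (realField R), Sum.inr w' ∉ S)
    (hsupp : ∀ u : HeightOneSpectrum (𝓞 (realField R)), Sum.inl u ∈ S → u ≠ v₂ → u ≠ w →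
      ∃ ℓ : ℕ, ℓ.Prime ∧ (ℓ : 𝓞 (realField R)) ∈ u.asIdeal ∧
        Sum.inl u ∈ badPlaces (ℓ : realField R) (AdjoinRoot.root (realPolyQ R)))
    (hsat : ∀ ℓ : ℕ, ℓ.Prime → ∀ u u' : HeightOneSpectrum (𝓞 (realField R)), u ≠ v₂ → u ≠ w → u' ≠ v₂ → u' ≠ w →
      (ℓ : 𝓞 (realField R)) ∈ u.asIdeal → Sum.inl u ∈ S →
      Sum.inl u' ∈ badPlaces (ℓ : realField R) (AdjoinRoot.root (realPolyQ R)) → Sum.inl u' ∈ S) :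
    ∃ c : ℚ, 0 < c ∧ badPlaces (c : realField R) (AdjoinRoot.root (realPolyQ R)) = S := by
  obtain ⟨P, hP, h⟩ := dFour_exists_primes_badPlaces_prod_eq hR hθ v₂ h2 w h7w hθw hfin heven hinf hsupp hsat
  have hpos : 0 < ∏ ℓ ∈ P, ℓ := Finset.prod_pos fun ℓ hℓ ↦ ((hP ℓ).1 hℓ).1.pos
  rcases h with h | h
  · exact ⟨((∏ ℓ ∈ P, ℓ : ℕ) : ℚ), by exact_mod_cast hpos, by rw [Rat.cast_natCast]; exact h⟩
  · exact ⟨((7 * ∏ ℓ ∈ P, ℓ : ℕ) : ℚ), by exact_mod_cast Nat.mul_pos (by norm_num) hpos, by rw [Rat.cast_natCast]; exact h⟩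

/-! ### §174 `ℚ(√-(3+√2))`: the span theorem — rational rows characterised -/

/-- **`ℚ(√-(3+√2))` — THE SPAN OF THE RATIONAL ROWS (cell (xvi′) as ONE statement).**  A set `S` of places of `F = ℚ(√2)` is a
rational row `T(c)`, `c ∈ ℚ_{>0}`, IF AND ONLY IF: `S` is finite of even size; no infinite place lies in `S`; every `u ∈ S` off
`Z = {v₂, 𝔭_θ}` lies over a prime `ℓ` with `u ∈ T(ℓ)`; and `S` is saturated along the prime pieces: `u ∈ S ∖ Z` over `ℓ` and
`u' ∈ T(ℓ) ∖ Z` imply `u' ∈ S`.  (⟹: Hilbert reciprocity 71:18, `c > 0` at the real places, the shape of a rational row and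
both-or-none — parts 41, 55, 57; ⟸: §173.)  With part 56's prime rows the admissible places are `v₂`, `𝔭_θ`, `(ℓ)` for the private
inert `ℓ`, the bad place `v₁` of each lonely split `ℓ`, and BOTH places of each private non-lonely split `ℓ` together.
[cite: Deligne1982HodgeCycles, §4 (1) and Cor. 4.2] [cite: Omeara1963, §63B Example 63:12 and §71D Thm. 71:18] -/
theorem dFour_exists_ratCast_badPlaces_eq_iff (hR : R = X ^ 2 + C 6 * X + C 7) {θₒ : 𝓞 (realField R)}
    (hθ : (θₒ : realField R) = AdjoinRoot.root (realPolyQ R)) (v₂ : HeightOneSpectrum (𝓞 (realField R)))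
    (h2 : (2 : 𝓞 (realField R)) ∈ v₂.asIdeal) (w : HeightOneSpectrum (𝓞 (realField R)))
    (h7w : ((7 : ℕ) : 𝓞 (realField R)) ∈ w.asIdeal) (hθw : θₒ ∈ w.asIdeal)
    (S : Set (HeightOneSpectrum (𝓞 (realField R)) ⊕ InfinitePlace (realField R))) :
    (∃ c : ℚ, 0 < c ∧ badPlaces (c : realField R) (AdjoinRoot.root (realPolyQ R)) = S) ↔
      S.Finite ∧ Even S.ncard ∧ (∀ w' : InfinitePlace (realField R), Sum.inr w' ∉ S) ∧
      (∀ u : HeightOneSpectrum (𝓞 (realField R)), Sum.inl u ∈ S → u ≠ v₂ → u ≠ w →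
        ∃ ℓ : ℕ, ℓ.Prime ∧ (ℓ : 𝓞 (realField R)) ∈ u.asIdeal ∧
          Sum.inl u ∈ badPlaces (ℓ : realField R) (AdjoinRoot.root (realPolyQ R))) ∧
      (∀ ℓ : ℕ, ℓ.Prime → ∀ u u' : HeightOneSpectrum (𝓞 (realField R)), u ≠ v₂ → u ≠ w → u' ≠ v₂ → u' ≠ w →
        (ℓ : 𝓞 (realField R)) ∈ u.asIdeal → Sum.inl u ∈ S →
        Sum.inl u' ∈ badPlaces (ℓ : realField R) (AdjoinRoot.root (realPolyQ R)) → Sum.inl u' ∈ S) := by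
  constructor
  · rintro ⟨c, hc, rfl⟩
    have hc0 : (c : realField R) ≠ 0 := by exact_mod_cast hc.ne'
    have hTe := even_ncard_badPlaces (R := R) (Units.mk0 (c : realField R) hc0)
    rw [Units.val_mk0] at hTe
    have hroots := roots_real_neg_of_quadratic hR (by norm_num) (by norm_num) (by norm_num)
    refine ⟨hTe.1, hTe.2, fun w' ↦ inr_notMem_badPlaces_ratCast_of_pos hroots w' hc, fun u huS huv huw ↦ ?_,
      fun ℓ hℓ u u' huv huw hu'v hu'w hℓu huS hu'T ↦ ?_⟩
    · rcases dFour_mem_badPlaces_ratCast_cases hR hθ v₂ h2 w h7w hθw hc huS with h | h | ⟨u₁, ℓ, hu₁, hℓ, -, -, hℓu, -, hT⟩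
      · exact absurd (Sum.inl_injective h) huv
      · exact absurd (Sum.inl_injective h) huw
      · obtain rfl : u = u₁ := Sum.inl_injective hu₁
        exact ⟨ℓ, hℓ, hℓu, hT⟩
    · -- `u' ∈ T(ℓ) ∖ Z` is an odd place `∌ θ` over `ℓ` (part 55); `ord_ℓ(c)` is odd because `u ∈ T(c)` lies over `ℓ` (part 57)
      obtain ⟨u₂, hu₂, h2u', -, hu'⟩ := dFour_exists_of_mem_badPlaces_natCast_diff_dyadic hR hθ v₂ h2 w h7w hθw hℓ
        (x := Sum.inl u') ⟨hu'T, fun h ↦ hu'v (Sum.inl_injective h)⟩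
      rw [← Sum.inl_injective hu₂] at h2u' hu'
      rcases hu' with h | ⟨hθu', hℓu'⟩
      · exact absurd h hu'w
      · rcases dFour_mem_badPlaces_ratCast_cases hR hθ v₂ h2 w h7w hθw hc huS with
            h | h | ⟨u₁, ℓ₁, hu₁, hℓ₁, -, -, hℓ₁u, hodd, -⟩
        · exact absurd (Sum.inl_injective h) huv
        · exact absurd (Sum.inl_injective h) huw
        · rw [← Sum.inl_injective hu₁] at hℓ₁u
          have hℓℓ : ℓ₁ = ℓ := prime_natCast_mem_unique hℓ₁ hℓ u hℓ₁u hℓu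
          rw [hℓℓ] at hodd
          exact (dFour_inl_mem_badPlaces_ratCast_iff_of_root_notMem hθ u' h2u' hθu' hℓ hℓu' hc).2 ⟨hodd, hu'T⟩
  · rintro ⟨hfin, heven, hinf, hsupp, hsat⟩
    exact dFour_exists_ratCast_badPlaces_eq hR hθ v₂ h2 w h7w hθw hfin heven hinf hsupp hsat

end DFourSpan

end Summit.HodgeConjecture.HodgeConjecture.Ring2.WeilCoverageCM

end
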